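import Summits.CriticalPhenomena.PercolationContinuityZ3.Theorems.Transplant.AutEndStateTypesCyclic
import HarnessLib

/-!
# The twist criterion, III (def-free existence forms): generalised dihedral groups `N ⋊ ⟨inversion⟩` need at least TWO types (`p2 = Dih(ℤ²)`), and a point group of
# order FOUR on `ℤ²` exists (`p4`: at least four types) — the planar type numbers `2, 3, 4, 6` are all in the tree

builds on p205010 (kernel theorem, internal audit signed; external expert review pending) — nothing in this file uses p205010; UNCONDITIONAL (pure group theory);
nothing is claimed about any open node.  Lane `prim-bschramm`, seat `prim-bschramm-p4` gen 28 (PART C3 of `P4-GENERAL.md` §50.11).  Helper file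
(`--supports stmt-CriticalPhenomena-4575 --as helper`); def-free (the concrete-group API `Planar.rot4/Grp4/Grp2` lives in `AutEndStateTypesPlanarDefs`; its theorem file
`AutEndStateTypesPlanar` is staged behind the build lane — this file states the same type numbers without new definitions).

* **`Twist.Dih.dvd_index` / `le_card_reps_of_grr`** — `N` abelian without 2-torsion and non-trivial: every subgroup of `N ⋊ ⟨inversion⟩` with a rank-two `ℤ²`-character has
  EVEN index; ≥ 2 types on a GRR.  `Twist.Dih.dvd_index_intSq` — the instance `N = ℤ²` (the wallpaper group `p2`).
* **`Twist.exists_pointGroup_four` / `exists_grp_four_types`** — the quarter turn `(x, y) ↦ (−y, x)` has order `4` with fixed-point-free non-trivial powers: `p4 → 4 ∣` index,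
  ≥ 4 types on a GRR (`Twist.Cyclic.le_card_reps_of_grr`).  With `AutEndStateTypesCyclic` (`p6 → 6`, `p3 → 3`) and `AutEndStateTypes` (`ℤ^p ⋊ C_p → p`) every
  rotation/inversion point group of the plane is covered; the reflection groups (pm, pmm, p4m, …: fixed LINES, rank 1) are instances of `Twist.dvd_index` as well
  (one dependent-fixed-points check each; not typed).
[cite: BenjaminiSchramm1996, Conj. 4; §2 (Cayley graphs; almost transitive graphs)] [cite: KozmaNitzan2024, §4 p. 16 (Lemma 8: the role of the lattice symmetries)]
[cite: LeemannDelasalle2022, Cor. 1.2]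
-/

noncomputable section

namespace Summit.CriticalPhenomena.PercolationContinuityZ3.Theorems.Transplant

open SimpleGraph Literature.Probability.LatticeModels
open scoped Classical

/-! ## §1 Generalised dihedral groups `Dih(N) = N ⋊ ⟨inversion⟩` over an abelian group without 2-torsion (`p2 = Dih(ℤ²)`) -/

namespace Twist.Dih

variable {N : Type} [CommGroup N]

/-- In an abelian group without 2-torsion and with a non-trivial element, the inversion has order `2`. [folklore] -/
theorem orderOf_inv [Nontrivial N] (htf : ∀ v : N, v⁻¹ = v → v = 1) : orderOf (MulEquiv.inv N) = 2 := by
  refine (orderOf_eq_iff (by norm_num)).2 ⟨?_, fun m hm hm0 heq => ?_⟩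
  · exact MulEquiv.ext fun v => by rw [pow_two, MulAut.mul_apply, MulAut.one_apply]; exact inv_inv v
  · interval_cases m
    rw [pow_one] at heq
    obtain ⟨v, hv⟩ := exists_ne (1 : N)
    exact hv (htf v (by have h := congrArg (fun τ : MulAut N => τ v) heq; exact h))

/-- **The inversion fixes only the identity** (no 2-torsion), so the fixed points of every non-identity element of `⟨inversion⟩` are dependent. [folklore] -/
theorem hfix_inv [Nontrivial N] (htf : ∀ v : N, v⁻¹ = v → v = 1) :
    ∀ f : Subgroup.zpowers (MulEquiv.inv N), f ≠ 1 → ∀ v w : N, (Subgroup.zpowers (MulEquiv.inv N)).subtype f v = v →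
      (Subgroup.zpowers (MulEquiv.inv N)).subtype f w = w → ∃ k l : ℤ, (k ≠ 0 ∨ l ≠ 0) ∧ v ^ k = w ^ l := by
  intro f hf v w hv hw
  have hfin : IsOfFinOrder (MulEquiv.inv N) :=
    isOfFinOrder_iff_pow_eq_one.2 ⟨2, by norm_num, ((orderOf_eq_iff (by norm_num)).1 (orderOf_inv htf)).1⟩
  have hmem : (f : MulAut N) ∈ (Finset.range (orderOf (MulEquiv.inv N))).image (MulEquiv.inv N ^ ·) :=
    (hfin.mem_zpowers_iff_mem_range_orderOf).1 f.2
  rw [orderOf_inv htf, Finset.mem_image] at hmem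
  obtain ⟨k, hk, hfk⟩ := hmem
  rw [Finset.mem_range] at hk
  interval_cases k
  · exact absurd (Subtype.ext (by rw [← hfk, pow_zero]; rfl)) hf
  · rw [Subgroup.coe_subtype, ← hfk, pow_one] at hv hw
    refine ⟨1, 1, Or.inl one_ne_zero, ?_⟩
    rw [htf v hv, htf w hw]

/-- **`2 ∣ [Dih(N) : A₀]` for every subgroup of `N ⋊ ⟨inversion⟩` carrying a `ℤ²`-character of rank two** (`N` abelian without 2-torsion, e.g. `ℤⁿ`; the
generalised dihedral groups have `b₁ = 0`). [cite: BenjaminiSchramm1996, §2 (almost transitive graphs)] -/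
theorem dvd_index [Nontrivial N] (htf : ∀ v : N, v⁻¹ = v → v = 1)
    (A₀ : Subgroup (N ⋊[(Subgroup.zpowers (MulEquiv.inv N)).subtype] (Subgroup.zpowers (MulEquiv.inv N))))
    (c : A₀ →* Multiplicative (Site 2)) (hrank : ∃ x y : A₀, MaxArea.det2 (Multiplicative.toAdd (c x)) (Multiplicative.toAdd (c y)) ≠ 0) :
    2 ∣ A₀.index := by
  have hcard : Nat.card (Subgroup.zpowers (MulEquiv.inv N)) = 2 := by rw [Nat.card_zpowers, orderOf_inv htf]
  haveI : Finite (Subgroup.zpowers (MulEquiv.inv N)) := Nat.finite_of_card_ne_zero (by rw [hcard]; norm_num)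
  have h := Twist.dvd_index (hfix_inv htf) A₀ c hrank
  rwa [hcard] at h

/-- **At least TWO types on a GRR of a generalised dihedral group `N ⋊ ⟨inversion⟩`** (`N` abelian, no 2-torsion, non-trivial).
[cite: BenjaminiSchramm1996, Conj. 4; §2 (Cayley graphs)] [cite: LeemannDelasalle2022, Cor. 1.2] -/
theorem le_card_reps_of_grr [Nontrivial N] (htf : ∀ v : N, v⁻¹ = v → v = 1)
    (S : Set (N ⋊[(Subgroup.zpowers (MulEquiv.inv N)).subtype] (Subgroup.zpowers (MulEquiv.inv N))))
    (hGRR : ∀ α : mulCayley S ≃g mulCayley S, ∀ v, α v = α 1 * v) (A : Subgroup (mulCayley S ≃g mulCayley S))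
    (reps : Finset (N ⋊[(Subgroup.zpowers (MulEquiv.inv N)).subtype] (Subgroup.zpowers (MulEquiv.inv N)))) (cA : A →* Multiplicative (Site 2))
    (horb : ∀ w, ∃ x : A, ∃ s ∈ reps, (x : mulCayley S ≃g mulCayley S) s = w)
    (hrank : ∃ x y : A, MaxArea.det2 (Multiplicative.toAdd (cA x)) (Multiplicative.toAdd (cA y)) ≠ 0) : 2 ≤ reps.card :=
  Twist.le_card_reps_of_grr 2 (fun A₀ c h => dvd_index htf A₀ c h) S hGRR A reps cA horb hrank

end Twist.Dih

namespace Twist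

/-- `ℤ²` (written multiplicatively) has no 2-torsion. [folklore] -/
theorem intSq_no_two_torsion (v : Multiplicative (Site 2)) (h : v⁻¹ = v) : v = 1 := by
  apply Multiplicative.toAdd.injective
  funext i
  have hi := congrArg (fun w : Multiplicative (Site 2) => Multiplicative.toAdd w i) h
  simp only [toAdd_inv, Pi.neg_apply] at hi
  rw [toAdd_one, Pi.zero_apply]
  omega

/-- **`p2 = Dih(ℤ²)`: every subgroup of `ℤ² ⋊ ⟨inversion⟩` with a rank-two `ℤ²`-character has even index** (≥ 2 types on a GRR by `Twist.Dih.le_card_reps_of_grr`).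
[cite: BenjaminiSchramm1996, §2 (almost transitive graphs)] -/
theorem Dih.dvd_index_intSq
    (A₀ : Subgroup (Multiplicative (Site 2) ⋊[(Subgroup.zpowers (MulEquiv.inv (Multiplicative (Site 2)))).subtype]
      (Subgroup.zpowers (MulEquiv.inv (Multiplicative (Site 2))))))
    (c : A₀ →* Multiplicative (Site 2)) (hrank : ∃ x y : A₀, MaxArea.det2 (Multiplicative.toAdd (c x)) (Multiplicative.toAdd (c y)) ≠ 0) : 2 ∣ A₀.index := by
  haveI : Nontrivial (Multiplicative (Site 2)) :=
    ⟨⟨Multiplicative.ofAdd (Pi.single 0 (1 : ℤ) : Site 2), 1, fun h => by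
      have h' := congrArg (fun w : Multiplicative (Site 2) => Multiplicative.toAdd w 0) h
      simp only [toAdd_ofAdd, Pi.single_eq_same, toAdd_one, Pi.zero_apply] at h'
      exact one_ne_zero h'⟩⟩
  exact Dih.dvd_index intSq_no_two_torsion A₀ c hrank

/-! ## §2 A point group of order four on `ℤ²` (`p4`) -/

/-- **The quarter turn `(x, y) ↦ (−y, x)` of `ℤ²` has order `4` and its non-trivial powers fix only the origin.** [folklore] -/
theorem exists_pointGroup_four : ∃ ρ : MulAut (Multiplicative (Site 2)), orderOf ρ = 4 ∧
    ∀ k : ℕ, 0 < k → k < 4 → ∀ v : Multiplicative (Site 2), (ρ ^ k) v = v → v = 1 := by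
  let ρ : MulAut (Multiplicative (Site 2)) :=
    { toFun := fun v => Multiplicative.ofAdd ![-(Multiplicative.toAdd v 1), Multiplicative.toAdd v 0]
      invFun := fun v => Multiplicative.ofAdd ![Multiplicative.toAdd v 1, -(Multiplicative.toAdd v 0)]
      left_inv := fun v => Multiplicative.toAdd.injective (funext fun i => by
        fin_cases i
        · rfl
        · show -(-(Multiplicative.toAdd v 1)) = Multiplicative.toAdd v 1
          omega)
      right_inv := fun v => Multiplicative.toAdd.injective (funext fun i => by
        fin_cases i
        · show -(-(Multiplicative.toAdd v 0)) = Multiplicative.toAdd v 0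
          omega
        · rfl)
      map_mul' := fun v w => Multiplicative.toAdd.injective (funext fun i => by
        fin_cases i
        · show -(Multiplicative.toAdd v 1 + Multiplicative.toAdd w 1) = -(Multiplicative.toAdd v 1) + -(Multiplicative.toAdd w 1)
          omega
        · rfl) }
  have h0 : ∀ v, Multiplicative.toAdd (ρ v) 0 = -(Multiplicative.toAdd v 1) := fun v => rfl
  have h1 : ∀ v, Multiplicative.toAdd (ρ v) 1 = Multiplicative.toAdd v 0 := fun v => rfl
  have p2 : ∀ v, Multiplicative.toAdd ((ρ ^ 2) v) 0 = -(Multiplicative.toAdd v 0) ∧ Multiplicative.toAdd ((ρ ^ 2) v) 1 = -(Multiplicative.toAdd v 1) :=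
    fun v => by
    refine ⟨?_, ?_⟩
    · rw [pow_two, MulAut.mul_apply, h0, h1]
    · rw [pow_two, MulAut.mul_apply, h1, h0]
  have e3 : ρ ^ 3 = ρ * ρ ^ 2 := by rw [show (3 : ℕ) = 1 + 2 from rfl, pow_add, pow_one]
  have p3 : ∀ v, Multiplicative.toAdd ((ρ ^ 3) v) 0 = Multiplicative.toAdd v 1 ∧ Multiplicative.toAdd ((ρ ^ 3) v) 1 = -(Multiplicative.toAdd v 0) :=
    fun v => by
    refine ⟨?_, ?_⟩
    · rw [e3, MulAut.mul_apply, h0, (p2 v).2]; omega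
    · rw [e3, MulAut.mul_apply, h1, (p2 v).1]
  have p4 : ρ ^ 4 = 1 := by
    refine MulEquiv.ext fun v => Multiplicative.toAdd.injective (funext fun i => ?_)
    rw [show (4 : ℕ) = 1 + 3 from rfl, pow_add, pow_one, MulAut.mul_apply, MulAut.one_apply]
    fin_cases i
    · show Multiplicative.toAdd (ρ ((ρ ^ 3) v)) 0 = Multiplicative.toAdd v 0
      rw [h0, (p3 v).2]; omega
    · show Multiplicative.toAdd (ρ ((ρ ^ 3) v)) 1 = Multiplicative.toAdd v 1
      rw [h1, (p3 v).1]
  have hfix : ∀ k : ℕ, 0 < k → k < 4 → ∀ v : Multiplicative (Site 2), (ρ ^ k) v = v → v = 1 := by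
    intro k hk0 hk v hv
    have e0 := congrArg (fun w : Multiplicative (Site 2) => Multiplicative.toAdd w 0) hv
    have e1 := congrArg (fun w : Multiplicative (Site 2) => Multiplicative.toAdd w 1) hv
    apply Multiplicative.toAdd.injective
    funext i
    rw [toAdd_one, Pi.zero_apply]
    interval_cases k
    · rw [pow_one, h0] at e0; rw [pow_one, h1] at e1
      fin_cases i
      · show Multiplicative.toAdd v 0 = 0; omega
      · show Multiplicative.toAdd v 1 = 0; omega
    · rw [(p2 v).1] at e0; rw [(p2 v).2] at e1
      fin_cases i
      · show Multiplicative.toAdd v 0 = 0; omega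
      · show Multiplicative.toAdd v 1 = 0; omega
    · rw [(p3 v).1] at e0; rw [(p3 v).2] at e1
      fin_cases i
      · show Multiplicative.toAdd v 0 = 0; omega
      · show Multiplicative.toAdd v 1 = 0; omega
  refine ⟨ρ, (orderOf_eq_iff (by norm_num)).2 ⟨p4, fun m hm hm0 heq => ?_⟩, hfix⟩
  have key := hfix m hm0 hm (Multiplicative.ofAdd (Pi.single 0 (1 : ℤ) : Site 2)) (by rw [heq, MulAut.one_apply])
  have h := congrArg (fun w : Multiplicative (Site 2) => Multiplicative.toAdd w 0) key
  simp only [toAdd_ofAdd, Pi.single_eq_same, toAdd_one, Pi.zero_apply] at h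
  exact one_ne_zero h

/-- **THEOREM (`p4`: at least FOUR types, existence form).**  There is `ρ ∈ Aut(ℤ²)` of order four such that every subgroup of `ℤ² ⋊ ⟨ρ⟩` carrying a `ℤ²`-character
of rank two has index divisible by `4` (hence ≥ 4 vertex orbits for every end-state datum on a GRR, `Twist.Cyclic.le_card_reps_of_grr`).
[cite: BenjaminiSchramm1996, Conj. 4; §2] [cite: KozmaNitzan2024, §4 p. 16 (Lemma 8)] -/
theorem exists_grp_four_types : ∃ ρ : MulAut (Multiplicative (Site 2)), orderOf ρ = 4 ∧
    ∀ (A₀ : Subgroup (Multiplicative (Site 2) ⋊[(Subgroup.zpowers ρ).subtype] (Subgroup.zpowers ρ))) (c : A₀ →* Multiplicative (Site 2)),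
      (∃ x y : A₀, MaxArea.det2 (Multiplicative.toAdd (c x)) (Multiplicative.toAdd (c y)) ≠ 0) → 4 ∣ A₀.index := by
  obtain ⟨ρ, hρ, hfix⟩ := exists_pointGroup_four
  exact ⟨ρ, hρ, fun A₀ c hrank => Cyclic.dvd_index ρ hρ (by norm_num) hfix A₀ c hrank⟩

end Twist

end Summit.CriticalPhenomena.PercolationContinuityZ3.Theorems.Transplant

end
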